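import Literature.NumberTheory.DiophantineGeometry.SimplestQuarticThue

/-!
# The simplest quartic Thue equations: symmetries and the elementary part of [ChenVoutier1997, §3.2]

Proved companions of the named fact
`Literature.NumberTheory.DiophantineGeometry.SimplestQuarticThueSolutions` ([ChenVoutier1997, Thm 3] =
[LettlPetho1995]; statement file `SimplestQuarticThue.lean`), following the printed proof where it is
elementary:

* symmetries of `P_t(X, Y) = X⁴ − tX³Y − 6X²Y² + tXY³ + Y⁴`: even (`simplestQuarticForm_neg_neg`), the
  order-four automorphism `(x, y) ↦ (y, −x)` (`simplestQuarticForm_rotate`), the norm-form shape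
  `u² − tuv − 4v²`, `u = x² − y²`, `v = xy` (`simplestQuarticForm_eq_normForm`), and closure of the
  `t = 4` solution list under the automorphism (`mem_list_four_rotate`);
* [ChenVoutier1997, §3.2], the paragraph "Let us first consider `y = 0` and `|y| = 1`": PROVED for every
  `t ≥ 1` (`simplestQuarticForm_at_one`, `simplestQuarticThue_abs_y_le_one`), extended by the
  automorphism to `min(|x|, |y|) ≤ 1` (`simplestQuarticThueSolutions_of_min_abs_le_one`);
* the reduction of the fact to its hard core (`simplestQuarticThueSolutions_of_two_le_abs`): it remains
  to show that the solutions with `|x|, |y| ≥ 2` are exactly `±(2, 3), ±(3, −2)` at `t = 4`.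

Scope of the printed proofs (why the fact itself is not discharged here): [ChenVoutier1997, §3] proves
Theorem 3 by the Thue–Siegel hypergeometric method **only for `t ≥ 128`** (p. 5: "we shall refer the
reader to [LP] for `1 ≤ t ≤ 127` and only prove this theorem for `t ≥ 128`"); the exponent of their
irrationality measure (Thm 5) is `κ = log(8ε)/log(ε/8)`, `ε = (t + √(t² + 16))/4`, and
`κ < 3 ⟺ ε > 64`, so `t ≥ 128` is intrinsic to that construction (Lemmas 1–8: Thue's recurrences,
contour-integral remainder bounds, Chudnovsky's denominator lemma, the approximation lemma).  The
range `1 ≤ t ≤ 127` rests on [LettlPetho1995] (lower bounds for linear forms in two logarithms plus a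
reduction step).  Neither ingredient is in Mathlib.

## References

* Chen Jian Hua, P. M. Voutier, *Complete solution of the Diophantine equation `X² + 1 = dY⁴` and a
  related family of quartic Thue equations*, J. Number Theory 62 (1997) 71–99, §3.2. [ChenVoutier1997]
* G. Lettl, A. Pethő, *Complete solution of a family of quartic Thue equations*, Abh. Math. Sem.
  Univ. Hamburg 65 (1995) 365–383. [LettlPetho1995]
-/

namespace Literature.NumberTheory.DiophantineGeometry

/-- `P_t` is an even form: `P_t(−x, −y) = P_t(x, y)`. [folklore] -/
theorem simplestQuarticForm_neg_neg (t x y : ℤ) :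
    simplestQuarticForm t (-x) (-y) = simplestQuarticForm t x y := by
  simp only [simplestQuarticForm]; ring

/-- The order-four symmetry of `P_t` (`x + iy ↦ −i(x + iy)`): `P_t(y, −x) = P_t(x, y)`. [folklore] -/
theorem simplestQuarticForm_rotate (t x y : ℤ) :
    simplestQuarticForm t y (-x) = simplestQuarticForm t x y := by
  simp only [simplestQuarticForm]; ring

/-- Norm-form shape [ChenVoutier1997, §4]: `P_t(x, y) = u² − t·u·v − 4v²`, `u = x² − y²`, `v = xy`
(the norm of `u − vε`, `ε² = tε + 4`). [folklore] -/
theorem simplestQuarticForm_eq_normForm (t x y : ℤ) :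
    simplestQuarticForm t x y =
      (x ^ 2 - y ^ 2) ^ 2 - t * ((x ^ 2 - y ^ 2) * (x * y)) - 4 * (x * y) ^ 2 := by
  simp only [simplestQuarticForm]; ring

/-- The (corrected) `t = 4` list is closed under the symmetry `(x, y) ↦ (y, −x)` of `P_t`, as a
complete solution set must be (the printed one, with `(−2, 3)`, is not: it contains `(3, −2)` but not
its image `(−2, −3)`). [folklore] -/
theorem mem_list_four_rotate {x y : ℤ}
    (h : (x, y) ∈ ({(-3, 2), (-2, -3), (-1, 0), (0, 1), (0, -1), (1, 0), (2, 3), (3, -2)} :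
      Set (ℤ × ℤ))) :
    (y, -x) ∈ ({(-3, 2), (-2, -3), (-1, 0), (0, 1), (0, -1), (1, 0), (2, 3), (3, -2)} :
      Set (ℤ × ℤ)) := by
  simp only [Set.mem_insert_iff, Set.mem_singleton_iff, Prod.mk.injEq] at h ⊢
  omega

/-- [ChenVoutier1997, §3.2, case `y = 1`]: for `t ≥ 1`, `P_t(x, 1) = 1`, i.e.
`x(x³ − tx² − 6x + t) = 0`, forces `x = 0`, and `P_t(x, 1) = −1`, i.e. `x⁴ − tx³ − 6x² + tx + 2 = 0`,
forces `(t, x) = (1, −2)`.  (Printed via rational roots; here: `t(x² − 1) = x³ − 6x` pins `−2 ≤ x ≤ 5`,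
resp. `x ∣ 2`, then case by case.) [cite: ChenVoutier1997, §3.2] -/
theorem simplestQuarticForm_at_one {t x : ℤ} (ht : 1 ≤ t) :
    (simplestQuarticForm t x 1 = 1 → x = 0) ∧
      (simplestQuarticForm t x 1 = -1 → t = 1 ∧ x = -2) := by
  constructor
  · intro h
    have h0 : x * (x * (x ^ 2 - 6) - t * (x ^ 2 - 1)) = 0 := by
      simp only [simplestQuarticForm] at h; linear_combination h
    rcases mul_eq_zero.1 h0 with hx | hx
    · exact hx
    · exfalso
      have h1 : t * (x ^ 2 - 1) = x ^ 3 - 6 * x := by linear_combination -hx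
      have hxle : x ≤ 5 := by
        rcases le_or_gt x 5 with hx5 | hx6
        · exact hx5
        exfalso
        have hpos : (0 : ℤ) < x ^ 2 - 1 := by nlinarith
        have h2 : (x - t) * (x ^ 2 - 1) = 5 * x := by linear_combination -h1
        have hxt : 1 ≤ x - t := by
          rcases le_or_gt 1 (x - t) with hle | hlt
          · exact hle
          nlinarith [mul_nonneg (show (0 : ℤ) ≤ t - x by omega) hpos.le]
        nlinarith [mul_le_mul_of_nonneg_right hxt hpos.le,
          mul_nonneg (show (0 : ℤ) ≤ x - 6 by omega) (show (0 : ℤ) ≤ x by omega)]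
      have hxge : -2 ≤ x := by
        rcases le_or_gt (-2) x with hx2 | hx3
        · exact hx2
        exfalso
        have hx9 : (0 : ℤ) ≤ x ^ 2 - 9 := by
          nlinarith [mul_nonneg (show (0 : ℤ) ≤ -x - 3 by omega) (show (0 : ℤ) ≤ -x + 3 by omega)]
        nlinarith [mul_nonneg (show (0 : ℤ) ≤ t - 1 by omega) (show (0 : ℤ) ≤ x ^ 2 - 1 by linarith),
          mul_nonneg (show (0 : ℤ) ≤ -x - 3 by omega) (show (0 : ℤ) ≤ x ^ 2 - 6 by linarith)]
      interval_cases x <;> omega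
  · intro h
    have h1 : t * x * (x ^ 2 - 1) = x ^ 4 - 6 * x ^ 2 + 2 := by
      simp only [simplestQuarticForm] at h; linear_combination -h
    have hd : x ∣ 2 := ⟨t * (x ^ 2 - 1) - x ^ 3 + 6 * x, by linear_combination -h1⟩
    have hx1 : x ≤ 2 := Int.le_of_dvd (by norm_num) hd
    have hx2 : -2 ≤ x := by
      have := Int.le_of_dvd (by norm_num) ((neg_dvd).2 hd)
      omega
    interval_cases x <;> omega

/-- [ChenVoutier1997, §3.2]: for `t ≥ 1` the solutions of `P_t(x, y) = ±1` with `|y| ≤ 1` are the four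
trivial points `(±1, 0), (0, ±1)` and, for `t = 1` only, `(−2, 1)` and `(2, −1)` (case `y = −1` from
`y = 1` by `P_t(x, −1) = P_t(−x, 1)`; `y = 0` gives `x⁴ = ±1`). [cite: ChenVoutier1997, §3.2] -/
theorem simplestQuarticThue_abs_y_le_one {t x y : ℤ} (ht : 1 ≤ t)
    (hP : simplestQuarticForm t x y = 1 ∨ simplestQuarticForm t x y = -1) (hy : |y| ≤ 1) :
    (x, y) ∈ ({(1, 0), (-1, 0), (0, 1), (0, -1)} : Set (ℤ × ℤ)) ∨
      (t = 1 ∧ ((x, y) = (-2, 1) ∨ (x, y) = (2, -1))) := by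
  simp only [Set.mem_insert_iff, Set.mem_singleton_iff, Prod.mk.injEq]
  obtain ⟨hy1, hy2⟩ := abs_le.1 hy
  have hcore := simplestQuarticForm_at_one (x := x) ht
  have hcore' := simplestQuarticForm_at_one (x := -x) ht
  interval_cases y
  · -- `y = -1`: `P_t(x, −1) = P_t(−x, 1)`
    have e : simplestQuarticForm t x (-1) = simplestQuarticForm t (-x) 1 := by
      simp only [simplestQuarticForm]; ring
    rw [e] at hP
    rcases hP with hP | hP
    · have := hcore'.1 hP; omega
    · have := hcore'.2 hP; omega
  · -- `y = 0`: `x⁴ = ±1`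
    have e : simplestQuarticForm t x 0 = x ^ 4 := by simp [simplestQuarticForm]
    rw [e] at hP
    have hx0 : 0 ≤ x ^ 4 := by positivity
    have hx4 : x ^ 4 = 1 := by omega
    have hle : x ^ 2 ≤ 1 := by nlinarith [sq_nonneg (x ^ 2 - 1)]
    have hge : 1 ≤ x ^ 2 := by nlinarith [mul_nonneg (sub_nonneg.2 hle) (sq_nonneg x)]
    obtain rfl | rfl : x = 1 ∨ x = -1 := by
      have hx1 : x ≤ 1 := by nlinarith
      have hx2 : -1 ≤ x := by nlinarith
      have hx3 : x ≠ 0 := by rintro rfl; norm_num at hge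
      omega
    all_goals norm_num
  · -- `y = 1`
    rcases hP with hP | hP
    · have := hcore.1 hP; omega
    · have := hcore.2 hP; omega

/-- The same for `|x| ≤ 1`, by the symmetry `P_t(y, −x) = P_t(x, y)`: the trivial points and, for
`t = 1` only, `(−1, −2)` and `(1, 2)`. [cite: ChenVoutier1997, §3.2] -/
theorem simplestQuarticThue_abs_x_le_one {t x y : ℤ} (ht : 1 ≤ t)
    (hP : simplestQuarticForm t x y = 1 ∨ simplestQuarticForm t x y = -1) (hx : |x| ≤ 1) :
    (x, y) ∈ ({(1, 0), (-1, 0), (0, 1), (0, -1)} : Set (ℤ × ℤ)) ∨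
      (t = 1 ∧ ((x, y) = (-1, -2) ∨ (x, y) = (1, 2))) := by
  have hP' : simplestQuarticForm t y (-x) = 1 ∨ simplestQuarticForm t y (-x) = -1 := by
    rwa [simplestQuarticForm_rotate]
  have := simplestQuarticThue_abs_y_le_one ht hP' (by rwa [abs_neg])
  simp only [Set.mem_insert_iff, Set.mem_singleton_iff, Prod.mk.injEq] at this ⊢
  rcases this with (⟨h1, h2⟩ | ⟨h1, h2⟩ | ⟨h1, h2⟩ | ⟨h1, h2⟩) | ⟨rfl, ⟨h1, h2⟩ | ⟨h1, h2⟩⟩ <;> omega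

/-- **`SimplestQuarticThueSolutions` holds for all solutions with `min(|x|, |y|) ≤ 1`** (every
`t ≥ 1`, `t ≠ 3`): the elementary part of [ChenVoutier1997, §3.2] ("for `y = 0` or `|y| = 1`, there are
no solutions of (3.1) except those mentioned in Theorem 3"), extended by the symmetry
`(x, y) ↦ (y, −x)`; the conclusion is literally that of the fact. [cite: ChenVoutier1997, §3.2] -/
theorem simplestQuarticThueSolutions_of_min_abs_le_one {t x y : ℤ} (ht : 1 ≤ t) (ht3 : t ≠ 3)
    (hP : simplestQuarticForm t x y = 1 ∨ simplestQuarticForm t x y = -1)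
    (hsmall : |x| ≤ 1 ∨ |y| ≤ 1) :
    (t = 1 ∧ (x, y) ∈ ({(-2, 1), (-1, -2), (-1, 0), (0, 1), (0, -1), (1, 0), (1, 2), (2, -1)} :
        Set (ℤ × ℤ))) ∨
      (t = 4 ∧ (x, y) ∈ ({(-3, 2), (-2, -3), (-1, 0), (0, 1), (0, -1), (1, 0), (2, 3), (3, -2)} :
        Set (ℤ × ℤ))) ∨
      ((t = 2 ∨ 5 ≤ t) ∧ (x, y) ∈ ({(1, 0), (-1, 0), (0, 1), (0, -1)} : Set (ℤ × ℤ))) := by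
  rcases hsmall with hx | hy
  · have := simplestQuarticThue_abs_x_le_one ht hP hx
    simp only [Set.mem_insert_iff, Set.mem_singleton_iff, Prod.mk.injEq] at this
    rcases this with (⟨rfl, rfl⟩ | ⟨rfl, rfl⟩ | ⟨rfl, rfl⟩ | ⟨rfl, rfl⟩) | ⟨rfl, ⟨rfl, rfl⟩ | ⟨rfl, rfl⟩⟩
    all_goals (simp; try omega)
  · have := simplestQuarticThue_abs_y_le_one ht hP hy
    simp only [Set.mem_insert_iff, Set.mem_singleton_iff, Prod.mk.injEq] at this
    rcases this with (⟨rfl, rfl⟩ | ⟨rfl, rfl⟩ | ⟨rfl, rfl⟩ | ⟨rfl, rfl⟩) | ⟨rfl, ⟨rfl, rfl⟩ | ⟨rfl, rfl⟩⟩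
    all_goals (simp; try omega)

/-- **Reduction of the fact to its hard core.**  By `simplestQuarticThueSolutions_of_min_abs_le_one`,
`SimplestQuarticThueSolutions` follows once the solutions with `|x| ≥ 2` and `|y| ≥ 2` are shown to be
exactly `±(2, 3), ±(3, −2)` at `t = 4` (and none for other `t ≥ 1`, `t ≠ 3`) — the part resting on
[ChenVoutier1997, Thm 5] (`t ≥ 128`) and [LettlPetho1995] (`t ≤ 127`). [folklore] -/
theorem simplestQuarticThueSolutions_of_two_le_abs
    (hlarge : ∀ t : ℤ, 1 ≤ t → t ≠ 3 → ∀ x y : ℤ, 2 ≤ |x| → 2 ≤ |y| →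
      (simplestQuarticForm t x y = 1 ∨ simplestQuarticForm t x y = -1) →
        t = 4 ∧ (x, y) ∈ ({(-3, 2), (-2, -3), (2, 3), (3, -2)} : Set (ℤ × ℤ))) :
    SimplestQuarticThueSolutions := by
  intro t ht ht3 x y hP
  rcases le_or_gt |x| 1 with hx | hx
  · exact simplestQuarticThueSolutions_of_min_abs_le_one ht ht3 hP (Or.inl hx)
  rcases le_or_gt |y| 1 with hy | hy
  · exact simplestQuarticThueSolutions_of_min_abs_le_one ht ht3 hP (Or.inr hy)
  obtain ⟨rfl, hmem⟩ := hlarge t ht ht3 x y (by omega) (by omega) hP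
  simp only [Set.mem_insert_iff, Set.mem_singleton_iff, Prod.mk.injEq] at hmem
  rcases hmem with ⟨rfl, rfl⟩ | ⟨rfl, rfl⟩ | ⟨rfl, rfl⟩ | ⟨rfl, rfl⟩ <;> simp

end Literature.NumberTheory.DiophantineGeometry
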